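import Summits.AtomisticToContinuum.BoseEinsteinCondensation.Theses.BECInsertionCorrector
import Summits.AtomisticToContinuum.BoseEinsteinCondensation.Theses.BECSectorPoincareTwoScale
import Summits.AtomisticToContinuum.BoseEinsteinCondensation.Theorems.StaticResponseBound.Negative.Basic
import Literature.MathematicalPhysics.QuantumManyBody.GroundStateDirichletForm

/-!
# Line `fsum-sector-sandwich` for crux `StaticResponseBound` (stmt-AtomisticToContinuum-12057)

**CRUX-PLAN VERDICT: NO-SKELETON.**  This file is a checked BRICK LIBRARY, *not* a registered
skeleton: it contains no `StaticResponseBound_of`.  Reason (details in `Lines/fsum-sector-sandwich.md`):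
the idea's lever — the moment sandwich `m₋₁ ≤ m₁/ω²` for the density wave in the ground-state
Dirichlet form — reaches only the `t → 0` (linear-response, `H₋₁`) content of the crux on the
infrared window, whereas the crux BY NAME is the all-states discriminant
`⟨∑ⱼcos(p·xⱼ)⟩_Ψ² ≤ 4CN(E_Ψ − E₀)/max(ρa,|p|²)` for every finite-energy `Ψ`, every `N`, every
`k ≠ 0` (Disproof.lean §A `forall_ineq_iff_discriminant`).  Sector floors, f-sum identities and
`H₋₁` data are blind to the quartic (Hartree) energy that controls multi-phonon coherences in the
all-states form (line card §"Two-phonon obstruction"); every concluding stub set in this currency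
would hide the crux in regime-restricted restatements (costume/shred).

What is kept, typed over existing declarations and `lean check`ed (sorries ONLY in `brick_*`):

* `brick_sectorFloorToHMinusOne`   (B1, the card's lemma, triage-sharpened): a floor `ω` on the
  sectorial Poincaré constant of the weight `|Θ|²` at `p = 2πk/L` gives the Kipnis–Varadhan datum
  `‖∑ⱼcos(p·xⱼ)‖²_{H₋₁(|Θ|²)} ≤ N|p|²/(2ω²)` — conclusion in the literal shape of support
  stmt-12060 `StaticResponseToHMinusOne`.
* `brick_energyFloorToPoincareFloor` (B4): an energy floor in the momentum sector `p` transfers to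
  the Poincaré constant of the exact (real, translation-invariant, `C¹`) minimiser — the
  ground-state representation, shared technical debt with stmt-12060.
* `brick_groundStateDiscriminant`  (B3): the crux's energy-currency body at one `(N, L, k)` plus an
  exact minimiser `Θ` give the ALL-STATES discriminant in Dirichlet-form language (the all-states
  version of stmt-12060).
* `brick_responseToHyperuniformity` (B2, the card's converse brick): the all-states discriminant
  with constant `K` forces `(∫V_p²|Θ|²)² ≤ K·N|p|²/8` (test `F = 1 + εV_p`).
* `floorSourced_hMinusOne` (sorry-free composition H):
  `LandauSectorBound → B4 → B1 →` on the IR window `|p| ≤ M₀√(ρa)`, for exact minimisers,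
  `hMinusOneSqW L |Θ| V_p ≤ N/(2θ²ρa)` — the route-level BYPASS: CorrectorClosure's `H₋₁` input
  sourced from stmt-9091 without the energy currency.
* `hyperuniformity_of_staticResponseBound` (sorry-free composition K):
  `StaticResponseBound → B3 → B2 →` `Var_{|Θ|²}(V_p)² ≤ CN²|p|²/(2 max(ρa,|p|²))`, i.e.
  `S(p) ≤ √(2C)|p|/√max(ρa,|p|²)` for exact minimisers — the kill-edge (¬hyperuniformity ⇒ ¬S).

Disproof.lean honoured: §B (`k ≠ 0`) — B2 carries `k ≠ 0`, B1's floor hypothesis is unsatisfiable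
at `k = 0` (`ω_Θ(0) = 0`); §E (finite-energy guard) — B3's body hypothesis keeps the guard
verbatim; §C (`C ≥ 1/2`) — B1 at `v = 0`, `ω = |p|²` returns `N/(2|p|²)`, the sharp free value;
§H (Bochner junk through arbitrary charges) — no brick takes a free function-valued charge: all
pairings are against continuous `V_p`, `C¹` tests and the continuous weight `‖Θ.ψ‖`.
Landed Negative lemmas (`Theorems/StaticResponseBound/Negative/Basic.lean`, `…/CellToolkit.lean`,
imported here as the scratch check): §A/§B/§G and the cell toolkit only — none is the negation of a
sector floor, an `H₋₁` bound, a variance bound or the ground-state representation, so no brick is an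
instance of a refuted statement; B3's last step is literally `Negative.forall_quad_iff`.
-/

noncomputable section

namespace Summit.AtomisticToContinuum.BoseEinsteinCondensation.Cruxes.StaticResponseBound.FsumSectorSandwich

open MeasureTheory
open scoped ENNReal
open Literature.MathematicalPhysics.QuantumManyBody.BoseGas
open Summit.AtomisticToContinuum.BoseEinsteinCondensation.Theses

/-! ### Notation -/

/-- `|p|² = (2π/L)² ∑ᵢ kᵢ²` — verbatim the crux's second `max` argument. -/
def psq (L : ℝ) (k : Fin 3 → ℤ) : ℝ :=
  (2 * Real.pi / L) ^ 2 * ∑ i, (k i : ℝ) ^ 2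

/-- The crux's observable `V_p(X) = ∑ⱼ cos(p·xⱼ)`, `p = 2πk/L` — verbatim the crux's integrand. -/
def densityCos (N : ℕ) (L : ℝ) (k : Fin 3 → ℤ) (X : Config N) : ℝ :=
  ∑ j : Fin N, Real.cos (2 * Real.pi / L * ∑ i, (k i : ℝ) * X j i)

/-! ### Brick statements -/

/-- **B1 (SectorFloorToHMinusOne, the sandwich `m₋₁ ≤ m₁/ω²`).** For a periodic trial state `Θ`
whose Born weight is translation invariant (total momentum `0`) and a floor `0 < ω ≤ ω_Θ(p)` on the
sectorial Poincaré constant at `p = 2πk/L`, the Kipnis–Varadhan `H₋₁` norm of `V_p = ∑ⱼ cos(p·xⱼ)`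
for the weight `|Θ|` obeys `‖V_p‖²₋₁ ≤ N|p|²/(2ω²)`.  Proof route (M): symmetrise the test `φ`
(concavity), project on the Bloch `∓p` components (only they pair with `ρ_{±p}` since `|Θ|²` is
translation invariant; the form is block-diagonal), Cauchy–Schwarz, Poincaré on `φ_p` AND on
`ρ_p` (Feynman–Bijl: `ω‖ρ_p‖² ≤ 𝓔_Θ(ρ_p) = N|p|²`, `groundStateDirichletForm_planeWaveSum`),
optimise `2bx − 2x²`; `ω_Θ(−p) = ω_Θ(p)` (`sectorPoincareConstant_neg`).  `k = 0` is excluded by the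
floor itself (`ω_Θ(0) = 0`).  With the Landau floor `ω = θ√(ρa)|p|` the bound is `N/(2θ²ρa)`. -/
def SectorFloorToHMinusOne : Prop :=
  ∀ (N : ℕ) (L : ℝ), 0 < L → ∀ (k : Fin 3 → ℤ) (Θ : PeriodicTrialState N L),
    HasTotalMomentum 0 Θ.ψ → ∀ ω : ℝ, 0 < ω →
      ENNReal.ofReal ω ≤ sectorPoincareConstant L Θ.ψ (latticeVec (2 * Real.pi / L) k) →
      hMinusOneSqW L (fun X => ‖Θ.ψ X‖)
          (fun X => ∑ j, Real.cos (2 * Real.pi / L * ∑ i, (k i : ℝ) * X j i)) ≤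
        ENNReal.ofReal (N * ((2 * Real.pi / L) ^ 2 * ∑ i, (k i : ℝ) ^ 2) / (2 * ω ^ 2))

/-- **B4 (EnergyFloorToPoincareFloor, ground-state representation).** If `Θ` is a real
non-negative, translation-invariant periodic trial state ATTAINING the (finite) periodic
ground-state energy, then an energy floor `E₀ + ω ≤ inf sp H(p)` in the momentum sector `p`
transfers to the Poincaré constant of the weight: `ω ≤ ω_Θ(p)`.  Proof route (M): for a Bloch-`p`
test `F` the ground-state transform `U_Θ F = FΘ/‖FΘ‖` (`PeriodicTrialState.gsTransform`) lies in
the sector (`hasTotalMomentum_gsTransform`), and `⟨FΘ,(H − E₀)FΘ⟩ = 𝓔_Θ(F)` by the weak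
Euler–Lagrange equation of the minimiser tested on `|F|²Θ` (reality of `Θ` kills the current
term); conclude with `le_sectorPoincareConstant_iff`.  Shared technical debt with stmt-12060. -/
def EnergyFloorToPoincareFloor : Prop :=
  ∀ (v : ℝ → ℝ≥0∞) (N : ℕ) (L : ℝ), 0 < L → ∀ (Θ : PeriodicTrialState N L),
    (∀ X, Θ.ψ X = (‖Θ.ψ X‖ : ℂ)) → HasTotalMomentum 0 Θ.ψ →
    periodicEnergy v Θ = periodicGroundStateEnergy v N L → periodicEnergy v Θ ≠ ⊤ →
    ∀ (m : Fin 3 → ℤ) (ω : ℝ), 0 ≤ ω →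
      periodicGroundStateEnergy v N L + ENNReal.ofReal ω ≤
          momentumSectorEnergy v N L (latticeVec (2 * Real.pi / L) m) →
      ENNReal.ofReal ω ≤ sectorPoincareConstant L Θ.ψ (latticeVec (2 * Real.pi / L) m)

/-- **B3 (GroundStateDiscriminant, all-states form of stmt-12060).** If `Θ` is a real
non-negative periodic trial state attaining the finite ground-state energy and the crux's
energy-currency bound `E₀ − B t² ≤ ⟨Ψ,HΨ⟩ + t⟨V_p⟩_Ψ` holds for all `t` and all finite-energy
`Ψ`, then for every Bose-symmetric periodic test `F`:
`(∫ V_p F² |Θ|²)² ≤ 4B (∫ F²|Θ|²) 𝓔_Θ(F)`.  Proof route (M): `Ψ_F = FΘ/‖FΘ‖`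
(`PeriodicTrialState.ofFun`), ground-state representation `E_{Ψ_F} − E₀ = 𝓔_Θ(F)/∫F²|Θ|²`, then the
discriminant of the quadratic in `t` (Disproof.lean §A `forall_quad_iff`).  Testing `F = 1 + εφ`
returns stmt-12060 (`hMinusOneSqW ≤ B`). -/
def GroundStateDiscriminant : Prop :=
  ∀ (v : ℝ → ℝ≥0∞) (N : ℕ) (L : ℝ), 0 < L → ∀ (Θ : PeriodicTrialState N L),
    (∀ X, Θ.ψ X = (‖Θ.ψ X‖ : ℂ)) →
    periodicEnergy v Θ = periodicGroundStateEnergy v N L → periodicEnergy v Θ ≠ ⊤ →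
    ∀ (k : Fin 3 → ℤ) (B : ℝ), 0 ≤ B →
      (∀ (t : ℝ) (Ψ : PeriodicTrialState N L), periodicEnergy v Ψ ≠ ⊤ →
        (periodicGroundStateEnergy v N L).toReal - B * t ^ 2 ≤
          (periodicEnergy v Ψ).toReal +
            t * ∫ X in cellN N L,
              (∑ j, Real.cos (2 * Real.pi / L * ∑ i, (k i : ℝ) * X j i)) * ‖Ψ.ψ X‖ ^ 2) →
      ∀ F : Config N → ℝ, IsPeriodicTest L F →
        (∀ (σ : Equiv.Perm (Fin N)) (X : Config N), F (X ∘ σ) = F X) →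
        (∫ X in cellN N L, densityCos N L k X * F X ^ 2 * ‖Θ.ψ X‖ ^ 2) ^ 2 ≤
          4 * B * (∫ X in cellN N L, F X ^ 2 * ‖Θ.ψ X‖ ^ 2) *
            dirichletFormW L (fun X => ‖Θ.ψ X‖) F F

/-- **B2 (ResponseToHyperuniformity, the converse brick `m₀² ≤ m₁ m₋₁` in variational dress).**
If the all-states discriminant holds for the translation-invariant weight `|Θ|²` with constant `K`
(for all Bose-symmetric periodic tests `F`), then `(∫ V_p² |Θ|²)² ≤ K · N|p|²/8`: test
`F = 1 + εV_p`, `ε → 0`, using `∫V_p|Θ|² = 0` and `𝓔_Θ(V_p) = N|p|²/2` (translation invariance,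
`k ≠ 0`, `2k ≠ 0`).  With `K = 4CN/max(ρa,|p|²)` and `∫V_p²|Θ|² = NS(p)/2` this reads
`S(p) ≤ √(2C)|p|/√max(ρa,|p|²)`, the body of TorusHyperuniformity (stmt-9093) for the minimiser. -/
def ResponseToHyperuniformity : Prop :=
  ∀ (N : ℕ) (L : ℝ), 0 < L → ∀ (k : Fin 3 → ℤ), k ≠ 0 → ∀ (Θ : PeriodicTrialState N L),
    HasTotalMomentum 0 Θ.ψ → ∀ K : ℝ, 0 ≤ K →
      (∀ F : Config N → ℝ, IsPeriodicTest L F →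
        (∀ (σ : Equiv.Perm (Fin N)) (X : Config N), F (X ∘ σ) = F X) →
        (∫ X in cellN N L, densityCos N L k X * F X ^ 2 * ‖Θ.ψ X‖ ^ 2) ^ 2 ≤
          K * (∫ X in cellN N L, F X ^ 2 * ‖Θ.ψ X‖ ^ 2) *
            dirichletFormW L (fun X => ‖Θ.ψ X‖) F F) →
      (∫ X in cellN N L, densityCos N L k X ^ 2 * ‖Θ.ψ X‖ ^ 2) ^ 2 ≤ K * (N * psq L k / 8)

/-! ### The bricks (the only `sorry`s of this file) -/

/-- B1 — see `SectorFloorToHMinusOne`. [difficulty M] -/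
theorem brick_sectorFloorToHMinusOne : SectorFloorToHMinusOne := by
  sorry

/-- B4 — see `EnergyFloorToPoincareFloor`. [difficulty M] -/
theorem brick_energyFloorToPoincareFloor : EnergyFloorToPoincareFloor := by
  sorry

/-- B3 — see `GroundStateDiscriminant`. [difficulty M] -/
theorem brick_groundStateDiscriminant : GroundStateDiscriminant := by
  sorry

/-- B2 — see `ResponseToHyperuniformity`. [difficulty M] -/
theorem brick_responseToHyperuniformity : ResponseToHyperuniformity := by
  sorry

/-! ### Auxiliary facts (sorry-free) -/

theorem psq_nonneg (L : ℝ) (k : Fin 3 → ℤ) : 0 ≤ psq L k := by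
  unfold psq; positivity

/-- `L = (N/ρ)^{1/3} > 0` for `N ≥ 1`, `ρ > 0`. -/
theorem sideLength_pos' {ρ : ℝ} (hρ : 0 < ρ) {N : ℕ} (hN : 0 < N) : 0 < sideLength ρ N := by
  unfold sideLength
  apply Real.rpow_pos_of_pos
  have : (0 : ℝ) < N := by exact_mod_cast hN
  positivity

/-- The Bloch phase of `LandauSectorBound` is the character of `latticeVec (2π/L) m`. -/
theorem sum_latticeVec_mul (L : ℝ) (m : Fin 3 → ℤ) (s : EuclideanSpace ℝ (Fin 3)) :
    (∑ j, (latticeVec (2 * Real.pi / L) m) j * s j) = 2 * Real.pi / L * ∑ t, (m t : ℝ) * s t := by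
  rw [Finset.mul_sum]
  exact Finset.sum_congr rfl fun t _ => by simp only [latticeVec, PiLp.toLp_apply]; ring

/-- The literal sector-floor body of `LandauSectorBound` at one `(N, L, m)` is a floor on
`momentumSectorEnergy` at `latticeVec (2π/L) m`. -/
theorem momentumSectorEnergy_floor_of_literal (v : ℝ → ℝ≥0∞) (N : ℕ) (L : ℝ) (m : Fin 3 → ℤ)
    (e : ℝ≥0∞)
    (h : ∀ Ψ : PeriodicTrialState N L,
      (∀ (X : Config N) (s : EuclideanSpace ℝ (Fin 3)), Ψ.ψ (fun j => X j + s) =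
        Complex.exp (Complex.I * ↑(2 * Real.pi / L * ∑ t : Fin 3, (m t : ℝ) * s t)) * Ψ.ψ X) →
      periodicGroundStateEnergy v N L + e ≤ periodicEnergy v Ψ) :
    periodicGroundStateEnergy v N L + e ≤ momentumSectorEnergy v N L (latticeVec (2 * Real.pi / L) m) := by
  rw [le_momentumSectorEnergy_iff]
  intro Ψ hΨ
  refine h Ψ fun X s => ?_
  have := hΨ s X
  rw [sum_latticeVec_mul] at this
  exact this

/-! ### Composition H — the floor-sourced `H₋₁` datum (route bypass), sorry-free -/

/-- **H.** `LandauSectorBound` (stmt-9091, BY NAME) `→ B4 → B1 →` on the infrared window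
`|p| ≤ M₀√(ρa)`, for every real non-negative translation-invariant exact minimiser `Θ` of the
periodic `N`-body energy (N large, density window `ρ/2 ≤ N/L³ ≤ 2ρ`):
`hMinusOneSqW L |Θ| (∑ⱼ cos(p·xⱼ)) ≤ N/(2θ²ρa)` — the `H₋₁` input of CorrectorClosure
(stmt-12058) in the shape of stmt-12060's conclusion, without the energy currency. -/
theorem floorSourced_hMinusOne (h1 : SectorFloorToHMinusOne) (h4 : EnergyFloorToPoincareFloor)
    (hLandau : BECSectorPoincareTwoScale.LandauSectorBound) :
    ∀ v : ℝ → ℝ≥0∞, IsRepulsiveFiniteRange v → ∀ M₀ : ℝ, 0 < M₀ → ∃ θ : ℝ, 0 < θ ∧ ∃ ρ₀ : ℝ, 0 < ρ₀ ∧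
      ∀ ρ : ℝ, 0 < ρ → ρ < ρ₀ → ∀ᶠ N : ℕ in Filter.atTop, ∀ L : ℝ, 0 < L →
        ρ / 2 ≤ (N : ℝ) / L ^ 3 → (N : ℝ) / L ^ 3 ≤ 2 * ρ → ∀ m : Fin 3 → ℤ, m ≠ 0 →
          2 * Real.pi / L * ‖(WithLp.toLp 2 fun t => (m t : ℝ) : EuclideanSpace ℝ (Fin 3))‖ ≤
              M₀ * Real.sqrt (ρ * (scatteringLength v).toReal) →
          ∀ Θ : PeriodicTrialState N L, (∀ X, Θ.ψ X = (‖Θ.ψ X‖ : ℂ)) → HasTotalMomentum 0 Θ.ψ →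
            periodicEnergy v Θ = periodicGroundStateEnergy v N L → periodicEnergy v Θ ≠ ⊤ →
            hMinusOneSqW L (fun X => ‖Θ.ψ X‖)
                (fun X => ∑ j, Real.cos (2 * Real.pi / L * ∑ i, (m i : ℝ) * X j i)) ≤
              ENNReal.ofReal (N / (2 * θ ^ 2 * (ρ * (scatteringLength v).toReal))) := by
  intro v hv M₀ hM₀
  obtain ⟨θ, hθ, ρ₀, hρ₀, hfloor⟩ := hLandau v hv M₀ hM₀
  refine ⟨θ, hθ, ρ₀, hρ₀, fun ρ hρ hρρ₀ => ?_⟩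
  filter_upwards [hfloor ρ hρ hρρ₀] with N hN
  intro L hL hw₁ hw₂ m hm hkM Θ hreal htr hmin hfin
  -- notation
  set a : ℝ := (scatteringLength v).toReal with ha_def
  set kk : ℝ := 2 * Real.pi / L * ‖(WithLp.toLp 2 fun t => (m t : ℝ) : EuclideanSpace ℝ (Fin 3))‖
    with hkk_def
  set ω : ℝ := θ * Real.sqrt (ρ * a) * kk with hω_def
  -- the literal Landau floor at this (N, L, m)
  have hlit := hN L hL hw₁ hw₂ m hm hkM
  -- positivity of the momentum and of ρa on the (non-empty) window
  have hm' : (WithLp.toLp 2 fun t => (m t : ℝ) : EuclideanSpace ℝ (Fin 3)) ≠ 0 := by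
    intro h0
    apply hm
    funext t
    have := congrArg (fun x : EuclideanSpace ℝ (Fin 3) => x t) h0
    simpa using this
  have hkkpos : 0 < kk := by
    rw [hkk_def]
    exact mul_pos (by positivity) (norm_pos_iff.mpr hm')
  have hsqrtpos : 0 < Real.sqrt (ρ * a) := by
    by_contra hle
    push Not at hle
    have : kk ≤ 0 := hkM.trans (by nlinarith [hM₀.le])
    linarith
  have hρa : 0 < ρ * a := Real.sqrt_pos.mp hsqrtpos
  have hωpos : 0 < ω := by rw [hω_def]; positivity
  -- B4: energy floor ⇒ Poincaré floor for the minimiser weight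
  have hsec : periodicGroundStateEnergy v N L + ENNReal.ofReal ω ≤
      momentumSectorEnergy v N L (latticeVec (2 * Real.pi / L) m) :=
    momentumSectorEnergy_floor_of_literal v N L m (ENNReal.ofReal ω) hlit
  have hP : ENNReal.ofReal ω ≤ sectorPoincareConstant L Θ.ψ (latticeVec (2 * Real.pi / L) m) :=
    h4 v N L hL Θ hreal htr hmin hfin m ω hωpos.le hsec
  -- B1: Poincaré floor ⇒ H₋₁ datum
  have hB1 := h1 N L hL m Θ htr ω hωpos hP
  refine hB1.trans (le_of_eq ?_)
  -- arithmetic: N |p|² / (2ω²) = N / (2θ²ρa)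
  have hnorm : ‖(WithLp.toLp 2 fun t => (m t : ℝ) : EuclideanSpace ℝ (Fin 3))‖ ^ 2 =
      ∑ i, (m i : ℝ) ^ 2 := by
    rw [EuclideanSpace.norm_eq, Real.sq_sqrt (Finset.sum_nonneg fun i _ => by positivity)]
    exact Finset.sum_congr rfl fun i _ => by simp [sq_abs]
  have hpsq : (2 * Real.pi / L) ^ 2 * ∑ i, (m i : ℝ) ^ 2 = kk ^ 2 := by
    rw [hkk_def, mul_pow, hnorm]
  have hω2 : ω ^ 2 = θ ^ 2 * (ρ * a) * kk ^ 2 := by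
    rw [hω_def, mul_pow, mul_pow, Real.sq_sqrt hρa.le]
  congr 1
  rw [hpsq, hω2]
  have hkk0 : kk ^ 2 ≠ 0 := pow_ne_zero 2 hkkpos.ne'
  have hθ0 : θ ^ 2 ≠ 0 := pow_ne_zero 2 hθ.ne'
  have hρa0 : ρ * a ≠ 0 := hρa.ne'
  field_simp

/-! ### Composition K — the kill-edge, sorry-free -/

/-- **K.** `StaticResponseBound` (BY NAME) `→ B3 → B2 →` for every exact real non-negative
translation-invariant minimiser `Θ` at `L = (N/ρ)^{1/3}`, `ρ < ρ₀(v)`, `k ≠ 0`: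
`(∫ V_p² |Θ|²)² ≤ 4 (CN/max(ρa,|p|²)) · N|p|²/8`, i.e. with `∫V_p²|Θ|² = N S(p)/2`:
`S(p) ≤ √(2C) |p| / √max(ρa,|p|²)` — hyperuniformity of torus minimisers is NECESSARY for the
crux (refute it and the crux dies on both routes wanting it). -/
theorem hyperuniformity_of_staticResponseBound (h2 : ResponseToHyperuniformity)
    (h3 : GroundStateDiscriminant) (hS : BECInsertionCorrector.StaticResponseBound) :
    ∀ v : ℝ → ℝ≥0∞, IsRepulsiveFiniteRange v → ∃ ρ₀ : ℝ, 0 < ρ₀ ∧ ∃ C : ℝ, 0 < C ∧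
      ∀ ρ : ℝ, 0 < ρ → ρ < ρ₀ → ∀ N : ℕ, 0 < N → ∀ k : Fin 3 → ℤ, k ≠ 0 →
        ∀ Θ : PeriodicTrialState N (sideLength ρ N), (∀ X, Θ.ψ X = (‖Θ.ψ X‖ : ℂ)) →
          HasTotalMomentum 0 Θ.ψ →
          periodicEnergy v Θ = periodicGroundStateEnergy v N (sideLength ρ N) →
          periodicEnergy v Θ ≠ ⊤ →
          (∫ X in cellN N (sideLength ρ N),
              densityCos N (sideLength ρ N) k X ^ 2 * ‖Θ.ψ X‖ ^ 2) ^ 2 ≤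
            4 * (C * N / max (ρ * (scatteringLength v).toReal) (psq (sideLength ρ N) k)) *
              (N * psq (sideLength ρ N) k / 8) := by
  intro v hv
  obtain ⟨ρ₀, hρ₀, C, hC, hbody⟩ := hS v hv
  refine ⟨ρ₀, hρ₀, C, hC, ?_⟩
  intro ρ hρ hρρ₀ N hN k hk Θ hreal htr hmin hfin
  have hL : 0 < sideLength ρ N := sideLength_pos' hρ hN
  have hM0 : 0 ≤ max (ρ * (scatteringLength v).toReal) (psq (sideLength ρ N) k) :=
    le_max_of_le_right (psq_nonneg _ k)
  have hB0 : 0 ≤ C * N / max (ρ * (scatteringLength v).toReal) (psq (sideLength ρ N) k) :=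
    div_nonneg (by positivity) hM0
  -- the crux's body at (ρ, N, k) in the shape B3 consumes (`B t²` with `B = CN/max`)
  have hbody' : ∀ (t : ℝ) (Ψ : PeriodicTrialState N (sideLength ρ N)), periodicEnergy v Ψ ≠ ⊤ →
      (periodicGroundStateEnergy v N (sideLength ρ N)).toReal -
          C * N / max (ρ * (scatteringLength v).toReal) (psq (sideLength ρ N) k) * t ^ 2 ≤
        (periodicEnergy v Ψ).toReal +
          t * ∫ X in cellN N (sideLength ρ N),
            (∑ j, Real.cos (2 * Real.pi / sideLength ρ N * ∑ i, (k i : ℝ) * X j i)) *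
              ‖Ψ.ψ X‖ ^ 2 := by
    intro t Ψ hΨ
    have h := hbody ρ hρ hρρ₀ N k hk t Ψ hΨ
    have hrw : C * t ^ 2 * (N : ℝ) / max (ρ * (scatteringLength v).toReal)
        ((2 * Real.pi / sideLength ρ N) ^ 2 * ∑ i, (k i : ℝ) ^ 2) =
        C * N / max (ρ * (scatteringLength v).toReal) (psq (sideLength ρ N) k) * t ^ 2 := by
      rw [psq]
      ring
    rw [hrw] at h
    exact h
  -- B3: all-states discriminant for the minimiser weight, constant 4B
  have hdisc := h3 v N (sideLength ρ N) hL Θ hreal hmin hfin k _ hB0 hbody'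
  -- B2: test on F = 1 + εV_p
  exact h2 N (sideLength ρ N) hL k hk Θ htr _ (mul_nonneg (by norm_num) hB0) hdisc

end Summit.AtomisticToContinuum.BoseEinsteinCondensation.Cruxes.StaticResponseBound.FsumSectorSandwich

end
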